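import Mathlib
import Summits.Ventures.PercRepro2.SwOutCrossBaseBlock
import Summits.Ventures.PercRepro2.SwOutJunctionH1Arms
import Summits.Ventures.PercRepro2.SwOutJunctionH1Inside
import Summits.Ventures.PercRepro2.SwOutJunctionH1Orbit
import Summits.Ventures.PercRepro2.SwOutMixedPartDefs

/-!
# The cross junction: vocabulary (blind cell PercRepro2, night-4 g24, 2026-08-28;
proofs/NIGHT4-G24.md §1)

THE CROSS JUNCTION (`CrossJunction`): the junction `u ∈ U ∖ {h, o}` (no loop, not adjacent to
`h`) and the DROPPED VERTICES `p i ∈ U ∖ {h, o, u}` (`i : X`, `p` injective), each adjacent to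
`u`, not adjacent to `h`, forming ONE component along the SIMPLE cross-edge graph `G`: an edge
`p i – p j` exists exactly when `G.Adj i j`, and then it is unique; (a) every neighbour of `u`
other than the `p i` is adjacent to `h`; (b′) every neighbour of `p i` inside `U` is `u` or a
`p j`; every other vertex of `U ∖ {h, o}` carries an outside edge or no edge.  (Boundary (iv) of
Theorem A_mix: several dropped vertices in one component, no pieces.)

THE BASE READ OFF A CONFIGURATION (`baseX`): the blue SIDE of `h` (`bside` = `C_B(h) ∖ C_R(h)`)
flipped to red, then every u–`p i` edge and every cross edge forced red and every outside edge of
a `p i` forced blue (`crossForce`).  THE ARMS of a configuration: the u-arms `uArmsX` (the arms of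
`armsC` containing no dropped vertex and adjacent to `u`) and the far arms `farArmsX`; the block of
a base `σ` (`blockX σ`) is the block `blockCX` of the cross base whose arms are read off `σ`.
-/

namespace Summit.Ventures.PercRepro2

namespace CrossArm

open Hull LocRows

variable {V : Type*} {E : Type*} [Fintype E] [DecidableEq E]

open scoped Classical

variable {ends : E → Sym2 V}

section Vocabulary

variable (ends) {X : Type*} (h u : V) (p : X → V) (G : SimpleGraph X)

/-- The u-arms of a configuration: the arms containing no dropped vertex, adjacent to `u`. -/
noncomputable def uArmsX (ζ : Config E) : Finset (Set V) :=
  (armsC ends h u ζ).filter fun P => (∀ i, p i ∉ P) ∧ ∃ e x, ends e = s(u, x) ∧ x ∈ P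

/-- The far arms of a configuration: the arms containing no dropped vertex, not adjacent to `u`. -/
noncomputable def farArmsX (ζ : Config E) : Finset (Set V) :=
  (armsC ends h u ζ).filter fun P => (∀ i, p i ∉ P) ∧ ¬ ∃ e x, ends e = s(u, x) ∧ x ∈ P

/-- The forcing: u–`p i` edges and cross edges red, outside edges of the dropped vertices blue. -/
noncomputable def crossForce (ζ : Config E) : Config E := fun e =>
  if (∃ i, ends e = s(u, p i)) ∨ ∃ i j, ends e = s(p i, p j) then true
  else if ∃ i x, ends e = s(p i, x) ∧ x ≠ u ∧ ∀ j, x ≠ p j then false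
  else ζ e

/-- **The base read off a configuration**: the blue side of `h` flipped to red, then forced. -/
noncomputable def baseX (ζ : Config E) : Config E :=
  crossForce ends u p (flip ends (bside ends ζ h) ζ)

/-- The u-arm index of a base. -/
abbrev ιX (σ : Config E) : Type _ := {P // P ∈ uArmsX ends h u p σ}

/-- The far-arm index of a base. -/
abbrev κX (σ : Config E) : Type _ := {P // P ∈ farArmsX ends h u p σ}

/-- The u-arms of a base. -/
def UX (σ : Config E) : ιX ends h u p σ → Set V := fun P => P.1

/-- The far arms of a base. -/
def FX (σ : Config E) : κX ends h u p σ → Set V := fun P => P.1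

variable [Fintype X] [DecidableRel G.Adj]

/-- **The block of a base**: the block of the cross base whose arms are read off the base. -/
noncomputable def blockX (σ : Config E) : Finset (Config E) :=
  blockCX ends σ u (UX ends h u p σ) p G (FX ends h u p σ)

/-- **The cross junction**: the junction `u` and the dropped vertices `p i` forming one
component along the simple cross-edge graph `G`. -/
structure CrossJunction (ends : E → Sym2 V) (U : Set V) (h u : V) (p : X → V)
    (G : SimpleGraph X) (o : V) : Prop where
  hne_hu : h ≠ u
  hne_hp : ∀ i, h ≠ p i
  hne_up : ∀ i, u ≠ p i
  p_inj : Function.Injective p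
  hou : o ≠ u
  hop : ∀ i, o ≠ p i
  hhU : h ∈ U
  huU : u ∈ U
  hpU : ∀ i, p i ∈ U
  hloop_h : ∀ e, ends e ≠ s(h, h)
  hloop_u : ∀ e, ends e ≠ s(u, u)
  hnadj : ∀ e, ends e ≠ s(h, u)
  hnadj_p : ∀ i e, ends e ≠ s(h, p i)
  hup : ∀ i, ∃ e, ends e = s(u, p i)
  /-- an edge for every edge of `G` -/
  hcross : ∀ i j, G.Adj i j → ∃ e, ends e = s(p i, p j)
  /-- a cross edge only along `G` -/
  hcross_adj : ∀ i j e, ends e = s(p i, p j) → G.Adj i j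
  /-- the cross edges are simple -/
  hcross_simple : ∀ i j e e', ends e = s(p i, p j) → ends e' = s(p i, p j) → e = e'
  /-- (a) every neighbour of `u` other than the dropped vertices is adjacent to `h`. -/
  hu_adj_h : ∀ e x, ends e = s(u, x) → (∀ i, x ≠ p i) → ∃ e', ends e' = s(x, h)
  /-- (b′) every neighbour of `p i` inside `U` is `u` or a dropped vertex. -/
  hp_in : ∀ i e x, ends e = s(p i, x) → x ∈ U → x = u ∨ ∃ j, x = p j
  hout : ∀ x ∈ U, x ≠ h → x ≠ o → x ≠ u →
    (∃ e y, ends e = s(x, y) ∧ y ∉ U) ∨ (∀ e, x ∉ ends e)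

end Vocabulary

section Basic

variable {X : Type*} {U : Set V} {h u o : V} {p : X → V} {G : SimpleGraph X}

omit [DecidableEq E] in
/-- Membership in the u-arms. -/
lemma mem_uArmsX_iff {ζ : Config E} {P : Set V} :
    P ∈ uArmsX ends h u p ζ ↔
      P ∈ armsC ends h u ζ ∧ (∀ i, p i ∉ P) ∧ ∃ e x, ends e = s(u, x) ∧ x ∈ P := by
  simp only [uArmsX, Finset.mem_filter]

omit [DecidableEq E] in
/-- Membership in the far arms. -/
lemma mem_farArmsX_iff {ζ : Config E} {P : Set V} :
    P ∈ farArmsX ends h u p ζ ↔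
      P ∈ armsC ends h u ζ ∧ (∀ i, p i ∉ P) ∧ ¬ ∃ e x, ends e = s(u, x) ∧ x ∈ P := by
  simp only [farArmsX, Finset.mem_filter]

omit [DecidableEq E] in
/-- The arms of two configurations with the same extended hull coincide. -/
lemma uArmsX_eq_of_extHull_eq {ζ ζ' : Config E}
    (hH : extHull ends ζ' h u = extHull ends ζ h u) :
    uArmsX ends h u p ζ' = uArmsX ends h u p ζ := by
  unfold uArmsX
  rw [armsC_eq_of_extHull_eq hH]

omit [DecidableEq E] in
/-- The far arms of two configurations with the same extended hull coincide. -/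
lemma farArmsX_eq_of_extHull_eq {ζ ζ' : Config E}
    (hH : extHull ends ζ' h u = extHull ends ζ h u) :
    farArmsX ends h u p ζ' = farArmsX ends h u p ζ := by
  unfold farArmsX
  rw [armsC_eq_of_extHull_eq hH]

omit [Fintype E] [DecidableEq E] in
/-- The forcing on a u–`p i` edge. -/
lemma crossForce_UP {ζ : Config E} {e : E} {i : X} (he : ends e = s(u, p i)) :
    crossForce ends u p ζ e = true := by
  simp only [crossForce]
  rw [if_pos (Or.inl ⟨i, he⟩)]

omit [Fintype E] [DecidableEq E] in
/-- The forcing on a cross edge. -/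
lemma crossForce_C {ζ : Config E} {e : E} {i j : X} (he : ends e = s(p i, p j)) :
    crossForce ends u p ζ e = true := by
  simp only [crossForce]
  rw [if_pos (Or.inr ⟨i, j, he⟩)]

omit [Fintype E] [DecidableEq E] in
/-- The forcing on an outside edge of a dropped vertex. -/
lemma crossForce_Ext (hne_up : ∀ i, u ≠ p i) {ζ : Config E} {e : E} {i : X} {x : V}
    (he : ends e = s(p i, x)) (hxu : x ≠ u) (hxp : ∀ j, x ≠ p j) :
    crossForce ends u p ζ e = false := by
  simp only [crossForce]
  rw [if_neg, if_pos ⟨i, x, he, hxu, hxp⟩]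
  rintro (⟨i', hi'⟩ | ⟨i', j', hij'⟩)
  · rw [he, Sym2.eq_iff] at hi'
    rcases hi' with ⟨h1, -⟩ | ⟨-, h2⟩
    · exact hne_up i h1.symm
    · exact hxu h2
  · rw [he, Sym2.eq_iff] at hij'
    rcases hij' with ⟨-, h2⟩ | ⟨-, h2⟩
    · exact hxp j' h2
    · exact hxp i' h2

omit [Fintype E] [DecidableEq E] in
/-- The forcing on an edge not at a dropped vertex. -/
lemma crossForce_of_not_p {ζ : Config E} {e : E} (he : ∀ i, p i ∉ ends e) :
    crossForce ends u p ζ e = ζ e := by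
  simp only [crossForce]
  rw [if_neg, if_neg]
  · rintro ⟨i, x, hix, -, -⟩
    exact he i (by rw [hix]; exact Sym2.mem_mk_left _ _)
  · rintro (⟨i, hi⟩ | ⟨i, j, hij⟩)
    · exact he i (by rw [hi]; exact Sym2.mem_mk_right _ _)
    · exact he i (by rw [hij]; exact Sym2.mem_mk_left _ _)

variable (hj : CrossJunction ends U h u p G o)
include hj

omit [Fintype E] [DecidableEq E] in
/-- No loop at a dropped vertex. -/
lemma CrossJunction.hloop_p (i : X) (e : E) : ends e ≠ s(p i, p i) :=
  fun he => G.irrefl (hj.hcross_adj i i e he)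

omit [Fintype E] [DecidableEq E] in
/-- A dropped vertex has an edge to the outside of `U`. -/
lemma CrossJunction.exists_ext_edge (i : X) :
    ∃ e y, ends e = s(p i, y) ∧ y ∉ U ∧ y ≠ u ∧ ∀ j, y ≠ p j := by
  rcases hj.hout (p i) (hj.hpU i) (hj.hne_hp i).symm (hj.hop i).symm (hj.hne_up i).symm with
    ⟨e, y, hey, hyU⟩ | h'
  · exact ⟨e, y, hey, hyU, fun h' => hyU (h' ▸ hj.huU), fun j h' => hyU (h' ▸ hj.hpU j)⟩
  · exfalso
    obtain ⟨e, he⟩ := hj.hup i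
    exact h' e (by rw [he]; exact Sym2.mem_mk_right _ _)

omit [Fintype E] [DecidableEq E] in
/-- Every dropped vertex has an outside-class edge. -/
lemma CrossJunction.exists_clsExtX (i : X) : ∃ e, e ∈ clsExtX ends u p i := by
  obtain ⟨e, y, hey, -, hyu, hyp⟩ := hj.exists_ext_edge i
  exact ⟨e, y, hey, hyu, hyp⟩

omit [Fintype E] [DecidableEq E] in
/-- Every edge of `G` has a cross-class edge. -/
lemma CrossJunction.exists_clsCX (s : G.edgeSet) : ∃ e, e ∈ clsCX ends p G s := by
  obtain ⟨s, hs⟩ := s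
  induction s using Sym2.ind with
  | h i j =>
    obtain ⟨e, he⟩ := hj.hcross i j (G.mem_edgeSet.1 hs)
    exact ⟨e, i, j, rfl, he⟩

omit [Fintype E] [DecidableEq E] in
/-- A neighbour of a dropped vertex: `u`, an adjacent dropped vertex, or a vertex outside `U`. -/
lemma CrossJunction.p_nbr {i : X} {e : E} {x : V} (he : ends e = s(p i, x)) :
    x = u ∨ (∃ j, x = p j ∧ G.Adj i j) ∨ x ∉ U := by
  by_cases hxU : x ∈ U
  · rcases hj.hp_in i e x he hxU with hxu | ⟨j, rfl⟩
    · exact Or.inl hxu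
    · exact Or.inr (Or.inl ⟨j, rfl, hj.hcross_adj i j e he⟩)
  · exact Or.inr (Or.inr hxU)

end Basic

end CrossArm

end Summit.Ventures.PercRepro2
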